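import Literature.Computability.Complexity.PolyExistsNTIMEShuffle
import Literature.Computability.Complexity.TruncMapMachine
import Literature.Computability.Complexity.AaronsonVanMelkebeek2011
import HarnessLib

/-!
# `NSUBEXP` is closed under polynomially bounded existential projection (discharge)

Last of five files of the proof of the named fact
`Literature.Computability.Complexity.polyExists_NSUBEXP_subset_NSUBEXP`
(`AaronsonVanMelkebeek2011.lean`; Aaronson–van Melkebeek 2011, proof of Lemma 3.1: an `∃` of
polynomial length in front of an `NSUBEXP` predicate stays in `NSUBEXP`):
**`polyExists_NSUBEXP_subset_NSUBEXP_holds`**.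

## The verifier

Let `x ∈ L ↔ ∃ y, |y| ≤ p(|x|) ∧ ⟨x, y⟩ ∈ L'` with `L' ∈ NSUBEXP`, and let `r ≥ 1`. Write
`2n + 2 + p(n) ≤ A n^d + A` (`d ≥ 1`) and take the member `r' = 2dr` of the `NSUBEXP` presentation
of `L'`: a constant `c'`, a relation `R'` and a machine `M'` deciding `R' w z` on `boolPair w z`
within `c' · 2^{⌊|w|^{1/r'}⌋} + c'` steps for certificates `z` inside that bound. The verifier of
`L` for the bound `2^{⌊n^{1/r}⌋}` is the composite (Mathlib `TM2`, sequential composition with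
additive time `TM2ComputableAux.comp_outputsWithin`)

  `V = truncMapAux M₀ ⨟ M_sh ⨟ M'`,

where `M₀` is the compiled clock program (`x ↦ ⟨x, 1^{U(|x|)}⟩`, `PolyExistsNTIMEClock.lean`), so
that the tree's truncating wrapper `truncMapAux M₀` (`TruncMapMachine.lean`) cuts the witness
`v` to `U(|x|)` symbols at half a step per discarded symbol, and `M_sh` is the compiled shuffle
program (`⟨x, v⟩ ↦ ⟨⟨x, y⟩, z⟩`, `PolyExistsNTIMEShuffle.lean`). Its relation is
`R x v = R' ⟨x, y⟩ z` for the parts `y`, `z` the shuffle extracts from `v ↾ U(|x|)`.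

* Correctness (inside `polyExists_NSUBEXP_subset_NSUBEXP_holds`): `R x v → x ∈ L` because the extracted `y` has `|y| ≤ p(|x|)` and the
  extracted `z` is a certificate inside the bound of `M'`; conversely an honest `v = SProg.dbl y ++ 0 1 z`
  is shorter than the clock and passes the shuffle unchanged (`shuffleOut_honest`).
* Time (`outputsWithin_verifier`, `exists_time_bound`): `|v|/2 + Q(n) + K · 2^{⌊(2n+2+p(n))^{1/r'}⌋}`
  for a polynomial `Q`; by `exists_poly_le_two_pow_nthRoot` and `exists_two_pow_nthRoot_poly_le`
  (`PolyExistsNTIMEArith.lean`) this is `≤ |v|/2 + C · 2^{⌊n^{1/r}⌋} + C`, and with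
  `|v| ≤ c · 2^{⌊n^{1/r}⌋} + c`, `c ≥ 2C + 2`, within the budget `c · 2^{⌊n^{1/r}⌋} + c` of the
  tree's `NTIME` (`Nondeterministic.lean`).

## References

* S. Aaronson, D. van Melkebeek, *On circuit lower bounds from derandomization*, Theory of
  Computing 7 (2011) 177–184, §3.1 (proof of Lemma 3.1).
* S. Arora, B. Barak, *Computational Complexity: A Modern Approach*, CUP 2009, Def. 2.1 and
  Thm. 2.6 (verifier form of nondeterministic time; guess-and-verify), §1.3 (machine
  composition).
-/

noncomputable section

namespace Literature.Computability.Complexity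

namespace PolyExistsNTIME

open _root_.Computability Turing Polynomial ACom ExpPad

/-! ### The polynomial part of the running time -/

/-- The Horner value as a polynomial in the evaluation point. [folklore] -/
def hornerPoly : List ℕ → Polynomial ℕ
  | [] => 0
  | c :: ds => C c + X * hornerPoly ds

/-- `hornerPoly ds` evaluates to `hornerVal k ds`. [folklore] -/
theorem eval_hornerPoly (k : ℕ) : ∀ ds : List ℕ, (hornerPoly ds).eval k = hornerVal k ds
  | [] => by simp [hornerPoly, hornerVal]
  | c :: ds => by simp [hornerPoly, hornerVal, eval_hornerPoly k ds]

/-- The Horner cost as a polynomial in the evaluation point. [folklore] -/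
def cHornerPoly : List ℕ → Polynomial ℕ
  | [] => 0
  | c :: ds => cHornerPoly ds +
      ((C 7 * X + C 4) * hornerPoly ds + C 3 * (hornerPoly ds * X) + C 2) + C c

/-- `cHornerPoly ds` evaluates to `cHorner k ds`. [folklore] -/
theorem eval_cHornerPoly (k : ℕ) : ∀ ds : List ℕ, (cHornerPoly ds).eval k = cHorner k ds
  | [] => by simp [cHornerPoly, cHorner]
  | c :: ds => by simp [cHornerPoly, cHorner, eval_cHornerPoly k ds, eval_hornerPoly]

/-- The maximal pair length `m(n) = 2n + 2 + p(n)` as a polynomial. [folklore] -/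
def lenMPoly (p : Polynomial ℕ) : Polynomial ℕ := C 2 * X + C 2 + p

/-- `lenMPoly p` evaluates to `lenM p n`. [folklore] -/
@[simp] theorem eval_lenMPoly (p : Polynomial ℕ) (n : ℕ) : (lenMPoly p).eval n = lenM p n := by
  simp [lenMPoly, lenM]

/-- The iteration cost `cRootIter r' (m(n))` as a polynomial. [folklore] -/
def rootIterPoly (p : Polynomial ℕ) (r' : ℕ) : Polynomial ℕ :=
  (cPowPoly r').comp (lenMPoly p + 1) + C 8 * (lenMPoly p + 1) ^ r' + C 11

/-- `rootIterPoly` evaluates to `cRootIter r' (lenM p n)`. [folklore] -/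
@[simp] theorem eval_rootIterPoly (p : Polynomial ℕ) (r' n : ℕ) :
    (rootIterPoly p r').eval n = cRootIter r' (lenM p n) := by
  simp [rootIterPoly, cRootIter, eval_comp, eval_cPowPoly]

/-- `cRootIter` is monotone in the length. [folklore] -/
theorem cRootIter_mono (r' : ℕ) {μ μ' : ℕ} (h : μ ≤ μ') : cRootIter r' μ ≤ cRootIter r' μ' := by
  unfold cRootIter
  have h1 := cPow_mono (show μ + 1 ≤ μ' + 1 by omega) r'
  have h2 : (μ + 1) ^ r' ≤ (μ' + 1) ^ r' := Nat.pow_le_pow_left (by omega) r'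
  omega

/-- `lenB` is monotone in the length. [folklore] -/
theorem lenB_mono (r' c' : ℕ) {μ μ' : ℕ} (hr' : r' ≠ 0) (h : μ ≤ μ') : lenB r' c' μ ≤ lenB r' c' μ' := by
  unfold lenB
  have := Nat.pow_le_pow_right Nat.two_pos (nthRoot_mono_right hr' h)
  exact Nat.add_le_add_right (Nat.mul_le_mul_left _ this) _

/-- The maximal exponential `E(n) = 2^{⌊m(n)^{1/r'}⌋}`. [folklore] -/
def expMax (p : Polynomial ℕ) (r' n : ℕ) : ℕ := 2 ^ rootM p r' n

/-- The clock length in terms of `E(n)`: `U(n) = 2 p(n) + 2 + (c' E(n) + c')`. [folklore] -/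
theorem clockLen_eq (p : Polynomial ℕ) (r' c' n : ℕ) :
    clockLen p r' c' n = 2 * p.eval n + 2 + (c' * expMax p r' n + c') := rfl

/-- **The polynomial part** of the running time of the verifier (everything that is not a
multiple of `E(n)` or of the witness length), as a polynomial in `n`. [folklore] -/
def polyPart (p : Polynomial ℕ) (r' c' : ℕ) : Polynomial ℕ :=
  -- shuffle: 6n + cRestCore-bound + 6, without the `E`-multiples
  (C 6 * X + cHornerPoly (coeffList p) + (C 10 * p + C 7) + (C 4 * X + C 3) + C 1 +
    ((lenMPoly p + C 2) * (rootIterPoly p r' + C 2) + C 1) + C 1 +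
    (C 4 * lenMPoly p + C 1) + (C 1 + C c') + (C 5 * C c' + C 1) +
    (C 2 * (C 2 * p + C 2 + C c') + C 1) + (C 2 * lenMPoly p + C 1) +
    ((C 3 * C c' + C 1) + C 2 + (C 4 * p + C 1) + C 4 + (C 6 * X + C 1)) + C 6) +
  -- clock: cClock-bound + 1 + 5n + 2U + 11, without the `E`-multiples
  ((C 4 * X + C 1) + cHornerPoly (coeffList p) + (C 4 * X + C 7 * p + C 5) + C 1 +
    ((lenMPoly p + C 2) * (rootIterPoly p r' + C 2) + C 1) + C 1 + (C 4 * lenMPoly p + C 1) +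
    (C 1 + C c' + (C 4 * p + C 1) + C 2) + (C 4 * X + C 3) + (C 2 * lenMPoly p + C 1) + C 1 +
    C 5 * X + C 2 * (C 2 * p + C 2 + C c') + C 11) +
  -- the inner verifier: `c'`
  C c'

/-- The coefficient of `E(n)` in the running time of the verifier. [folklore] -/
def expCoeff (c' : ℕ) : ℕ :=
  -- shuffle: 10 + (c'+2) + 5c' + 2c' (inside `2U`) + 3c' = 11c' + 12; clock: 10 + (c'+2) + 2c'
  -- (inside `2U`) = 3c' + 12; inner verifier: c'
  15 * c' + 24

/-- **The time bound in closed form**: for `|y| ≤ p(n)`, `|v'| ≤ U(n)` and `m ≤ m(n)` the three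
summands of the running time of the verifier are at most
`polyPart(n) + expCoeff · E(n)`. [folklore] -/
theorem time_le_polyPart (p : Polynomial ℕ) {r' : ℕ} (hr' : r' ≠ 0) (c' n ylen vlen m : ℕ)
    (hy : ylen ≤ p.eval n) (hv : vlen ≤ clockLen p r' c' n) (hm : m ≤ lenM p n) :
    (c' * 2 ^ Nat.nthRoot r' m + c') + (cShuffle p r' c' n ylen vlen + 1) +
      (cClock p r' c' n + 1 + 3 * n + 2 * clockLen p r' c' n + 2 * n + 11) ≤
    (polyPart p r' c').eval n + expCoeff c' * expMax p r' n := by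
  -- abbreviations
  set P := p.eval n with hP
  set H := cHorner n (coeffList p) with hH
  set M := lenM p n with hM
  set E := expMax p r' n with hE
  set μ := 2 * n + 2 + ylen with hμ
  have hμM : μ ≤ M := by rw [hμ, hM, lenM]; omega
  have hmM : Nat.nthRoot r' m ≤ rootM p r' n := nthRoot_mono_right hr' hm
  have hμroot : Nat.nthRoot r' μ ≤ rootM p r' n := nthRoot_mono_right hr' hμM
  -- the exponential terms
  have hEm : 2 ^ Nat.nthRoot r' m ≤ E := Nat.pow_le_pow_right Nat.two_pos hmM
  have hEμ : 2 ^ Nat.nthRoot r' μ ≤ E := Nat.pow_le_pow_right Nat.two_pos hμroot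
  have hEM : 2 ^ rootM p r' n = E := rfl
  -- roots are at most the radicand
  have hrootM : rootM p r' n ≤ M := nthRoot_le_self hr' _
  have hrootμ : Nat.nthRoot r' μ ≤ M := hμroot.trans hrootM
  -- monotone costs
  have hIter : cRootIter r' μ ≤ cRootIter r' M := cRootIter_mono r' hμM
  have hB : lenB r' c' μ ≤ c' * E + c' := by
    have := lenB_mono r' c' hr' hμM
    rwa [show lenB r' c' M = c' * E + c' from rfl] at this
  have hExpμ : cExp (Nat.nthRoot r' μ) 1 ≤ 10 * E + 4 * M + 1 := by
    have := cExp_le (Nat.nthRoot r' μ) 1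
    omega
  have hExpM : cExp (rootM p r' n) 1 ≤ 10 * E + 4 * M + 1 := by
    have := cExp_le (rootM p r' n) 1
    omega
  have hU : clockLen p r' c' n = 2 * P + 2 + (c' * E + c') := rfl
  -- the product term is monotone
  have hprod : (μ + 2) * (cRootIter r' μ + 2) ≤ (M + 2) * (cRootIter r' M + 2) :=
    Nat.mul_le_mul (by omega) (by omega)
  -- evaluate the polynomial part
  have hpoly : (polyPart p r' c').eval n =
      (6 * n + H + (10 * P + 7) + (4 * n + 3) + 1 + ((M + 2) * (cRootIter r' M + 2) + 1) + 1 +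
        (4 * M + 1) + (1 + c') + (5 * c' + 1) + (2 * (2 * P + 2 + c') + 1) + (2 * M + 1) +
        ((3 * c' + 1) + 2 + (4 * P + 1) + 4 + (6 * n + 1)) + 6) +
      ((4 * n + 1) + H + (4 * n + 7 * P + 5) + 1 + ((M + 2) * (cRootIter r' M + 2) + 1) + 1 +
        (4 * M + 1) + (1 + c' + (4 * P + 1) + 2) + (4 * n + 3) + (2 * M + 1) + 1 + 5 * n +
        2 * (2 * P + 2 + c') + 11) + c' := by
    simp only [polyPart, eval_add, eval_mul, eval_C, eval_X, eval_cHornerPoly, eval_lenMPoly,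
      eval_rootIterPoly, ← hP, ← hH, ← hM]
  -- unfold the costs
  have hv' : vlen ≤ 2 * P + 2 + (c' * E + c') := hU ▸ hv
  have hShuffle : cShuffle p r' c' n ylen vlen + 1 ≤
      (6 * n + H + (10 * P + 7) + (4 * n + 3) + 1 + ((M + 2) * (cRootIter r' M + 2) + 1) + 1 +
        (4 * M + 1) + (1 + c') + (5 * c' + 1) + (2 * (2 * P + 2 + c') + 1) + (2 * M + 1) +
        ((3 * c' + 1) + 2 + (4 * P + 1) + 4 + (6 * n + 1)) + 6) +
      (11 * (c' * E) + 12 * E) := by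
    have e : cShuffle p r' c' n ylen vlen = 6 * n + (H + (10 * P + 7) + (4 * n + 3) + 1 +
        ((μ + 2) * (cRootIter r' μ + 2) + 1) + 1 + cExp (Nat.nthRoot r' μ) 1 +
        ((c' + 2) * 2 ^ Nat.nthRoot r' μ + 1 + c') + (5 * lenB r' c' μ + 1) + (2 * vlen + 1) +
        (2 * μ + 1) + ((3 * lenB r' c' μ + 1) + 2 + (4 * ylen + 1) + 4 + (6 * n + 1))) + 5 := by
      simp only [cShuffle, cRest, cRestCore, ← hP, ← hH, ← hμ]
    have h1 : (c' + 2) * 2 ^ Nat.nthRoot r' μ ≤ c' * E + 2 * E :=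
      calc (c' + 2) * 2 ^ Nat.nthRoot r' μ ≤ (c' + 2) * E := Nat.mul_le_mul_left _ hEμ
        _ = c' * E + 2 * E := add_mul _ _ _
    rw [e]
    omega
  have hClock : cClock p r' c' n + 1 + 3 * n + 2 * clockLen p r' c' n + 2 * n + 11 ≤
      ((4 * n + 1) + H + (4 * n + 7 * P + 5) + 1 + ((M + 2) * (cRootIter r' M + 2) + 1) + 1 +
        (4 * M + 1) + (1 + c' + (4 * P + 1) + 2) + (4 * n + 3) + (2 * M + 1) + 1 + 5 * n +
        2 * (2 * P + 2 + c') + 11) + (3 * (c' * E) + 12 * E) := by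
    have e : cClock p r' c' n = (4 * n + 1) + H + (4 * n + 7 * P + 5) + 1 +
        ((M + 2) * (cRootIter r' M + 2) + 1) + 1 + cExp (rootM p r' n) 1 +
        ((c' + 2) * E + 1 + c' + (4 * P + 1) + 2) + (4 * n + 3) + (2 * M + 1) := by
      simp only [cClock, ← hP, ← hH, ← hM, hEM]
    have h2 : (c' + 2) * E = c' * E + 2 * E := add_mul _ _ _
    rw [e, hU, h2]
    omega
  have hInner : c' * 2 ^ Nat.nthRoot r' m + c' ≤ c' + c' * E := by
    have := Nat.mul_le_mul_left c' hEm
    omega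
  have hc : expCoeff c' * E = 15 * (c' * E) + 24 * E := by rw [expCoeff]; ring
  rw [hpoly, hc]
  omega

/-- **Subexponential bound**: for `r ≠ 0` and `r' = 2 d r` with `2n + 2 + p(n) ≤ A n^d + A`
(`d ≠ 0`), the closed-form bound is `≤ C · 2^{⌊n^{1/r}⌋} + C` for a constant `C`, and so is the
clock length. [folklore] -/
theorem exists_time_bound (p : Polynomial ℕ) (c' : ℕ) {r d A : ℕ} (hr : r ≠ 0) (hd : d ≠ 0)
    (hA : ∀ n, lenM p n ≤ A * n ^ d + A) :
    ∃ C : ℕ, ∀ n,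
      (polyPart p (2 * d * r) c').eval n + expCoeff c' * expMax p (2 * d * r) n ≤
          C * 2 ^ Nat.nthRoot r n + C ∧
        clockLen p (2 * d * r) c' n ≤ C * 2 ^ Nat.nthRoot r n + C := by
  obtain ⟨C₁, hC₁⟩ := exists_poly_le_two_pow_nthRoot (polyPart p (2 * d * r) c') hr
  obtain ⟨D, hD⟩ := exists_two_pow_nthRoot_poly_le A hd hr
  obtain ⟨C₂, hC₂⟩ := exists_poly_le_two_pow_nthRoot (C 2 * p + C 2 + C c') hr
  have hE : ∀ n, expMax p (2 * d * r) n ≤ D * 2 ^ Nat.nthRoot r n := fun n => by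
    have h1 : expMax p (2 * d * r) n ≤ 2 ^ Nat.nthRoot (2 * d * r) (A * n ^ d + A) :=
      Nat.pow_le_pow_right Nat.two_pos
        (nthRoot_mono_right (Nat.mul_ne_zero (Nat.mul_ne_zero two_ne_zero hd) hr) (hA n))
    exact h1.trans (hD n)
  refine ⟨C₁ + expCoeff c' * D + C₂ + c' * D, fun n => ⟨?_, ?_⟩⟩
  · have h1 := hC₁ n
    have h2 := Nat.mul_le_mul_left (expCoeff c') (hE n)
    nlinarith [Nat.zero_le (2 ^ Nat.nthRoot r n), Nat.zero_le C₂, Nat.zero_le (c' * D)]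
  · rw [clockLen_eq]
    have h1 : 2 * p.eval n + 2 + c' ≤ C₂ * 2 ^ Nat.nthRoot r n + C₂ := by
      have := hC₂ n
      simpa using this
    have h2 := Nat.mul_le_mul_left c' (hE n)
    nlinarith [Nat.zero_le (2 ^ Nat.nthRoot r n), Nat.zero_le C₁, Nat.zero_le (expCoeff c' * D)]

/-- A polynomial bound `2n + 2 + p(n) ≤ A n^d + A` with `d ≠ 0`. [folklore] -/
theorem exists_lenM_le (p : Polynomial ℕ) : ∃ A d : ℕ, d ≠ 0 ∧ ∀ n, lenM p n ≤ A * n ^ d + A := by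
  obtain ⟨c₁, d₁, h⟩ := exists_eval_le_mul_pow_add (C 2 * X + C 2 + p)
  refine ⟨2 * c₁, max d₁ 1, by omega, fun n => ?_⟩
  have h1 : lenM p n ≤ c₁ * n ^ d₁ + c₁ := by simpa [lenM] using h n
  rcases Nat.eq_zero_or_pos n with rfl | hn
  · have : c₁ * 0 ^ d₁ ≤ c₁ := by
      rcases Nat.eq_zero_or_pos d₁ with rfl | hd₁ <;> simp [Nat.pos_iff_ne_zero.mp, *]
    calc lenM p 0 ≤ c₁ * 0 ^ d₁ + c₁ := h1
      _ ≤ 2 * c₁ * 0 ^ max d₁ 1 + 2 * c₁ := by omega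
  · have h2 : n ^ d₁ ≤ n ^ max d₁ 1 := Nat.pow_le_pow_right hn (le_max_left _ _)
    calc lenM p n ≤ c₁ * n ^ d₁ + c₁ := h1
      _ ≤ 2 * c₁ * n ^ max d₁ 1 + 2 * c₁ := by nlinarith

/-! ### The machines -/

/-- **The clock machine**: some `TM2` machine maps `x` to `boolPair x (1^{U(|x|)})` within
`cClock + 1` steps (the compiled clock program). [folklore] -/
theorem exists_clockMachine (p : Polynomial ℕ) {r' : ℕ} (hr' : r' ≠ 0) (c' : ℕ) :
    ∃ M₀ : TM2ComputableAux Bool Bool, ∀ x : List Bool,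
      M₀.OutputsWithin x (boolPair x (un (clockLen p r' c' x.length))) (cClock p r' c' x.length + 1) :=
  ACom.exists_computesInTime (clockProg p r' c') .inp .out (id : List Bool → List Bool) id
    (fun x => boolPair x (un (clockLen p r' c' x.length))) (fun x => cClock p r' c' x.length)
    (runs_clockProg p hr' c')

/-- **The shuffle machine**: some `TM2` machine maps `boolPair x v` to `shuffleOut p r' c' x v`
within `cShuffle + 1` steps (the compiled shuffle program, on the encoder
`(x, v) ↦ boolPair x v`). [folklore] -/
theorem exists_shuffleMachine (p : Polynomial ℕ) {r' : ℕ} (hr' : r' ≠ 0) (c' : ℕ) :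
    ∃ M : TM2ComputableAux Bool Bool, ∀ x v : List Bool,
      M.OutputsWithin (boolPair x v) (shuffleOut p r' c' x v)
        (cShuffle p r' c' x.length (yOf p x v).length v.length + 1) := by
  obtain ⟨M, hM⟩ := ACom.exists_computesInTime (shuffleProg p r' c') .inp .out
    (fun a : List Bool × List Bool => boolPair a.1 a.2) id (fun a => shuffleOut p r' c' a.1 a.2)
    (fun a => cShuffle p r' c' a.1.length (yOf p a.1 a.2).length a.2.length)
    (fun a => runs_shuffleProg p hr' c' a.1 a.2)
  exact ⟨M, fun x v => hM (x, v)⟩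

/-! ### The composite verifier -/

/-- The relation of the new verifier: the inner relation on the parts extracted by the shuffle
from the truncated witness. [folklore] -/
def newRel (p : Polynomial ℕ) (r' c' : ℕ) (R' : List Bool → List Bool → Bool) (x v : List Bool) : Bool :=
  R' (boolPair x (yOf p x (v.take (clockLen p r' c' x.length))))
    (zOf p r' c' x (v.take (clockLen p r' c' x.length)))

/-- **The composite verifier and its running time.** Given the inner verifier `M'` (deciding
`R' w z` on `boolPair w z` within `c' · 2^{⌊|w|^{1/r'}⌋} + c'` steps for certificates inside that
bound), the machine `truncMapAux M₀ ⨟ M_sh ⨟ M'` decides `newRel` on `boolPair x v` within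
`|v|/2 + polyPart(n) + expCoeff · E(n)` steps, for EVERY witness `v`. [folklore] -/
theorem outputsWithin_verifier (p : Polynomial ℕ) {r' : ℕ} (hr' : r' ≠ 0) (c' : ℕ)
    (R' : List Bool → List Bool → Bool) (M' : TM2ComputableAux Bool Bool)
    (hM' : ∀ w z : List Bool, z.length ≤ c' * 2 ^ Nat.nthRoot r' w.length + c' →
      M'.OutputsWithin (boolPair w z) (encodeBool (R' w z)) (c' * 2 ^ Nat.nthRoot r' w.length + c')) :
    ∃ V : TM2ComputableAux Bool Bool, ∀ x v : List Bool,
      V.OutputsWithin (boolPair x v) (encodeBool (newRel p r' c' R' x v))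
        (v.length / 2 + ((polyPart p r' c').eval x.length + expCoeff c' * expMax p r' x.length)) := by
  obtain ⟨M₀, hM₀⟩ := exists_clockMachine p hr' c'
  obtain ⟨Msh, hMsh⟩ := exists_shuffleMachine p hr' c'
  refine ⟨(truncMapAux M₀).comp (Msh.comp M'), fun x v => ?_⟩
  set n := x.length with hn
  set U := clockLen p r' c' n with hU
  set v' := v.take U with hv'
  set y := yOf p x v' with hy
  set z := zOf p r' c' x v' with hz
  -- stage 1: truncation
  have h1 := outputsWithin_truncMapAux_boolPair M₀ (y := v) (hM₀ x)
  rw [← hn] at h1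
  simp only [un, List.length_replicate] at h1
  rw [← hU, ← hv'] at h1
  -- stage 2: shuffle
  have h2 := hMsh x v'
  rw [← hn, ← hy] at h2
  -- stage 3: the inner verifier
  have hzlen : z.length ≤ c' * 2 ^ Nat.nthRoot r' (boolPair x y).length + c' := by
    have := length_zOf_le p r' c' x v'
    rwa [← hz, ← hy, lenB] at this
  have h3 := hM' (boolPair x y) z hzlen
  have hout : shuffleOut p r' c' x v' = boolPair (boolPair x y) z := by rw [shuffleOut, hy, hz]
  rw [hout] at h2
  have h23 := TM2ComputableAux.comp_outputsWithin Msh M' h2 h3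
  have h := TM2ComputableAux.comp_outputsWithin (truncMapAux M₀) (Msh.comp M') h1 h23
  have hrel : newRel p r' c' R' x v = R' (boolPair x y) z := by rw [newRel, ← hn, ← hU, ← hv', ← hy, ← hz]
  rw [hrel]
  refine h.mono ?_
  -- the time bound
  have hylen : y.length ≤ p.eval n := by rw [hy]; exact length_yOf_le p x v'
  have hvlen : v'.length ≤ U := by rw [hv', List.length_take]; exact Nat.min_le_left _ _
  have hm : (boolPair x y).length ≤ lenM p n := by rw [length_boolPair, lenM, ← hn]; omega
  have ht := time_le_polyPart p hr' c' n y.length v'.length (boolPair x y).length hylen hvlen hm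
  rw [length_boolPair, ← hn] at ht ⊢
  omega

/-! ### Correctness of the relation -/

/-- On an honest witness the shuffle extracts exactly its parts. [folklore] -/
theorem yOf_zOf_honest (p : Polynomial ℕ) {x y z : List Bool}
    (hy : y.length ≤ p.eval x.length) :
    yOf p x (SProg.dbl y ++ false :: true :: z) = y ∧ restOf p x (SProg.dbl y ++ false :: true :: z) = z := by
  have h := readY_dbl_sep z hy
  exact ⟨by rw [yOf, h], by rw [restOf, h]⟩

end PolyExistsNTIME

/-! ### The discharge -/

open PolyExistsNTIME _root_.Computability in
/-- **Discharge of `polyExists_NSUBEXP_subset_NSUBEXP`**: `polyExists NSUBEXP ⊆ NSUBEXP`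
(Aaronson–van Melkebeek 2011, proof of Lemma 3.1, in the tree's verifier-form `NTIME`): for
`x ∈ L ↔ ∃ y, |y| ≤ p(|x|) ∧ ⟨x, y⟩ ∈ L'` with `L' ∈ NSUBEXP` and `r ≥ 1`, the composite verifier
`truncMapAux M₀ ⨟ M_sh ⨟ M'` over the member `r' = 2dr` of the presentation of `L'`
(`outputsWithin_verifier`) decides the relation `newRel` within `c · 2^{⌊n^{1/r}⌋} + c` steps on
all witnesses of length `≤ c · 2^{⌊n^{1/r}⌋} + c` (`exists_time_bound`), and `newRel` presents `L`:
a true instance yields `⟨x, y⟩ ∈ L'` with `|y| ≤ p(|x|)`, and an honest witness `dbl y ++ 0 1 z`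
fits in the bound and is read back exactly. [cite: AaronsonMelkebeek2011, §3.1 (proof of Lemma 3.1)] -/
theorem polyExists_NSUBEXP_subset_NSUBEXP_holds : polyExists_NSUBEXP_subset_NSUBEXP := by
  rintro L ⟨L', hL', p, hp⟩
  rw [mem_NSUBEXP_iff]
  intro r hr
  have hr0 : r ≠ 0 := Nat.pos_iff_ne_zero.1 hr
  obtain ⟨A, d, hd, hA⟩ := exists_lenM_le p
  set r' := 2 * d * r with hr'
  have hr'0 : r' ≠ 0 := Nat.mul_ne_zero (Nat.mul_ne_zero two_ne_zero hd) hr0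
  obtain ⟨c', R', M', hM', hiff'⟩ := mem_NSUBEXP_iff.1 hL' r' (Nat.pos_of_ne_zero hr'0)
  obtain ⟨V, hV⟩ := outputsWithin_verifier p hr'0 c' R' M' hM'
  obtain ⟨C, hC⟩ := exists_time_bound p c' hr0 hd hA
  refine ⟨2 * C + 2, newRel p r' c' R', V, fun x v hv => ?_, fun x => ?_⟩
  · -- running time
    refine (hV x v).mono ?_
    have h1 := (hC x.length).1
    rw [← hr'] at h1
    set T := 2 ^ Nat.nthRoot r x.length with hT
    have e1 : (2 * C + 2) * T + (2 * C + 2) = 2 * (C * T) + 2 * T + 2 * C + 2 := by ring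
    change v.length ≤ (2 * C + 2) * T + (2 * C + 2) at hv
    change _ ≤ (2 * C + 2) * T + (2 * C + 2)
    rw [e1] at hv ⊢
    omega
  · -- the relation presents `L`
    constructor
    · intro hx
      obtain ⟨y, hy, hxy⟩ := (hp x).1 hx
      obtain ⟨z, hz, hRz⟩ := (hiff' (boolPair x y)).1 hxy
      simp only [length_boolPair] at hz
      have hlen : (SProg.dbl y ++ false :: true :: z).length ≤ clockLen p r' c' x.length := by
        simp only [List.length_append, SProg.length_dbl, List.length_cons, clockLen]
        have hmono : 2 ^ Nat.nthRoot r' (2 * x.length + 2 + y.length) ≤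
            2 ^ Nat.nthRoot r' (2 * x.length + 2 + p.eval x.length) :=
          Nat.pow_le_pow_right Nat.two_pos (nthRoot_mono_right hr'0 (by omega))
        have := Nat.mul_le_mul_left c' hmono
        omega
      refine ⟨SProg.dbl y ++ false :: true :: z, ?_, ?_⟩
      · -- the honest witness fits in the clock, and the clock in the budget
        have hU := (hC x.length).2
        rw [← hr'] at hU
        set T := 2 ^ Nat.nthRoot r x.length with hT
        have e1 : (2 * C + 2) * T + (2 * C + 2) = 2 * (C * T) + 2 * T + 2 * C + 2 := by ring
        change _ ≤ (2 * C + 2) * T + (2 * C + 2)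
        rw [e1]
        omega
      · -- and is read back exactly
        rw [newRel, List.take_of_length_le hlen]
        obtain ⟨hyo, hro⟩ := yOf_zOf_honest p (z := z) hy
        rw [zOf, hyo, hro, List.take_of_length_le]
        · exact hRz
        · rw [lenB]
          exact hz
    · rintro ⟨v, -, hR⟩
      rw [newRel] at hR
      set v' := v.take (clockLen p r' c' x.length)
      refine (hp x).2 ⟨yOf p x v', length_yOf_le p x v', (hiff' _).2 ⟨zOf p r' c' x v', ?_, hR⟩⟩
      have := length_zOf_le p r' c' x v'
      rwa [lenB] at this

end Literature.Computability.Complexity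

end
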